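import Mathlib
import Literature.Probability.Distributions.BrascampLiebOneDim
import HarnessLib

/-!
# Brascamp–Lieb on an open half-line, and the second-moment bound under a curvature floor

`Literature/Probability/Distributions/`. The one-dimensional Brascamp–Lieb inequality
(J. Funct. Anal. 22 (1976), Thm 4.1, `n = 1`) for a weight `e^{-g}` on an OPEN half-line `(l, ∞)`:
if `g ∈ C²(l, ∞)` with `g'' > 0` continuous and `g` has a critical point `a > l` (its minimum), then
for every `H ∈ C¹(l, ∞)`

  `∫_{(l,∞)} (H − H a)² e^{−g} ≤ ∫_{(l,∞)} H'²/g'' · e^{−g}`     (`brascampLieb_Ioi`, extended integrals),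

obtained from the tree's compact-interval form (`brascampLieb_interval_right/left`, file
`BrascampLiebOneDim`) by exhausting `(l, ∞)` with compact intervals containing `a` (monotone
convergence). No decay or integrability hypothesis is needed in the extended-integral form.

Consequence used by the Jensen-polynomial tail lemma (the measures `u^k Φ(u) du` on `(0, ∞)`,
eng-3's THEOREM A, (5.1)–(5.2)): with `H = id` and a TWO-PIECE CURVATURE FLOOR `g'' ≥ ρ` on `[b, ∞)`,
`g'' ≥ ρ'` on `(l, b)`,

  `∫_{(l,∞)} (x − a)² e^{−g} ≤ ρ⁻¹ ∫_{(l,∞) ∩ [b,∞)} e^{−g} + ρ'⁻¹ ∫_{(l,∞) ∩ (−∞,b)} e^{−g}`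

(`lintegral_sq_sub_mul_exp_neg_le_of_curvature`, and the Bochner form
`integral_sq_sub_mul_exp_neg_le_of_curvature` when `e^{−g}` is integrable), together with the
elementary facts that the second moment about the mean is at most the second moment about `a` and
that the mean lies within `√(second moment about a / mass)` of `a`
(`sq_mean_sub_le_div`, `integral_sq_sub_mean_le`). Theorems only; no definitions.

References: H. J. Brascamp, E. H. Lieb, J. Funct. Anal. 22 (1976) 366–389, Thm 4.1 (n = 1, p. 377).
-/

noncomputable section

open MeasureTheory Set Filter
open scoped Topology ENNReal

namespace Literature.Probability.Distributions

/-! ### Compact interval with an interior critical point -/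

/-- Brascamp–Lieb on `[α, β]` with the constant `H a` for a critical point `a ∈ [α, β]` of `g`
(`g' a = 0`): `∫_α^β (H − H a)² e^{-g} ≤ ∫_α^β H'²/g'' e^{-g}`.
[cite: BrascampLieb1976, Thm 4.1 (n = 1)] -/
theorem brascampLieb_interval_of_deriv_eq_zero {α β a : ℝ} (hαa : α ≤ a) (haβ : a ≤ β)
    {g g₁ g₂ H H₁ : ℝ → ℝ}
    (hg : ∀ x ∈ Icc α β, HasDerivAt g (g₁ x) x) (hg₁ : ∀ x ∈ Icc α β, HasDerivAt g₁ (g₂ x) x)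
    (hH : ∀ x ∈ Icc α β, HasDerivAt H (H₁ x) x)
    (hg₂c : ContinuousOn g₂ (Icc α β)) (hH₁c : ContinuousOn H₁ (Icc α β))
    (hpos : ∀ x ∈ Icc α β, 0 < g₂ x) (hga : g₁ a = 0) :
    ∫ x in α..β, (H x - H a) ^ 2 * Real.exp (-g x) ≤
      ∫ x in α..β, (H₁ x) ^ 2 / g₂ x * Real.exp (-g x) := by
  have hgc : ContinuousOn g (Icc α β) := fun x hx => (hg x hx).continuousAt.continuousWithinAt
  have hHc : ContinuousOn H (Icc α β) := fun x hx => (hH x hx).continuousAt.continuousWithinAt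
  have hsub1 : Icc a β ⊆ Icc α β := Icc_subset_Icc hαa le_rfl
  have hsub2 : Icc α a ⊆ Icc α β := Icc_subset_Icc le_rfl haβ
  have hR : ∫ x in a..β, (H x - H a) ^ 2 * Real.exp (-g x) ≤
      ∫ x in a..β, (H₁ x) ^ 2 / g₂ x * Real.exp (-g x) :=
    brascampLieb_interval_right haβ (fun x hx => hg x (hsub1 hx)) (fun x hx => hg₁ x (hsub1 hx))
      (fun x hx => hH x (hsub1 hx)) (hg₂c.mono hsub1) (hH₁c.mono hsub1)
      (fun x hx => hpos x (hsub1 hx)) hga.ge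
  have hL : ∫ x in α..a, (H x - H a) ^ 2 * Real.exp (-g x) ≤
      ∫ x in α..a, (H₁ x) ^ 2 / g₂ x * Real.exp (-g x) :=
    brascampLieb_interval_left hαa (fun x hx => hg x (hsub2 hx)) (fun x hx => hg₁ x (hsub2 hx))
      (fun x hx => hH x (hsub2 hx)) (hg₂c.mono hsub2) (hH₁c.mono hsub2)
      (fun x hx => hpos x (hsub2 hx)) hga.le
  have hc1 : ContinuousOn (fun x => (H x - H a) ^ 2 * Real.exp (-g x)) (Icc α β) :=
    ((hHc.sub continuousOn_const).pow 2).mul hgc.neg.rexp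
  have hc2 : ContinuousOn (fun x => (H₁ x) ^ 2 / g₂ x * Real.exp (-g x)) (Icc α β) :=
    ((hH₁c.pow 2).div hg₂c fun x hx => (hpos x hx).ne').mul hgc.neg.rexp
  have i1 : ∀ {s t : ℝ}, α ≤ s → s ≤ t → t ≤ β →
      IntervalIntegrable (fun x => (H x - H a) ^ 2 * Real.exp (-g x)) volume s t :=
    fun h1 h2 h3 => (hc1.mono (by rw [uIcc_of_le h2]; exact Icc_subset_Icc h1 h3)).intervalIntegrable
  have i2 : ∀ {s t : ℝ}, α ≤ s → s ≤ t → t ≤ β →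
      IntervalIntegrable (fun x => (H₁ x) ^ 2 / g₂ x * Real.exp (-g x)) volume s t :=
    fun h1 h2 h3 => (hc2.mono (by rw [uIcc_of_le h2]; exact Icc_subset_Icc h1 h3)).intervalIntegrable
  rw [← intervalIntegral.integral_add_adjacent_intervals (i1 le_rfl hαa haβ) (i1 hαa haβ le_rfl),
    ← intervalIntegral.integral_add_adjacent_intervals (i2 le_rfl hαa haβ) (i2 hαa haβ le_rfl)]
  linarith

/-- Extended-integral form of `brascampLieb_interval_of_deriv_eq_zero` over `Icc α β`.
[cite: BrascampLieb1976, Thm 4.1 (n = 1)] -/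
theorem lintegral_Icc_brascampLieb_of_deriv_eq_zero {α β a : ℝ} (hαa : α ≤ a) (haβ : a ≤ β)
    {g g₁ g₂ H H₁ : ℝ → ℝ}
    (hg : ∀ x ∈ Icc α β, HasDerivAt g (g₁ x) x) (hg₁ : ∀ x ∈ Icc α β, HasDerivAt g₁ (g₂ x) x)
    (hH : ∀ x ∈ Icc α β, HasDerivAt H (H₁ x) x)
    (hg₂c : ContinuousOn g₂ (Icc α β)) (hH₁c : ContinuousOn H₁ (Icc α β))
    (hpos : ∀ x ∈ Icc α β, 0 < g₂ x) (hga : g₁ a = 0) :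
    ∫⁻ x in Icc α β, ENNReal.ofReal ((H x - H a) ^ 2 * Real.exp (-g x)) ≤
      ∫⁻ x in Icc α β, ENNReal.ofReal ((H₁ x) ^ 2 / g₂ x * Real.exp (-g x)) := by
  have hαβ : α ≤ β := hαa.trans haβ
  have hgc : ContinuousOn g (Icc α β) := fun x hx => (hg x hx).continuousAt.continuousWithinAt
  have hHc : ContinuousOn H (Icc α β) := fun x hx => (hH x hx).continuousAt.continuousWithinAt
  have hc1 : ContinuousOn (fun x => (H x - H a) ^ 2 * Real.exp (-g x)) (Icc α β) :=
    ((hHc.sub continuousOn_const).pow 2).mul hgc.neg.rexp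
  have hc2 : ContinuousOn (fun x => (H₁ x) ^ 2 / g₂ x * Real.exp (-g x)) (Icc α β) :=
    ((hH₁c.pow 2).div hg₂c fun x hx => (hpos x hx).ne').mul hgc.neg.rexp
  have hi1 : IntegrableOn (fun x => (H x - H a) ^ 2 * Real.exp (-g x)) (Icc α β) :=
    hc1.integrableOn_compact isCompact_Icc
  have hi2 : IntegrableOn (fun x => (H₁ x) ^ 2 / g₂ x * Real.exp (-g x)) (Icc α β) :=
    hc2.integrableOn_compact isCompact_Icc
  have key := brascampLieb_interval_of_deriv_eq_zero hαa haβ hg hg₁ hH hg₂c hH₁c hpos hga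
  rw [intervalIntegral.integral_of_le hαβ, intervalIntegral.integral_of_le hαβ,
    ← integral_Icc_eq_integral_Ioc, ← integral_Icc_eq_integral_Ioc] at key
  rw [← ofReal_integral_eq_lintegral_ofReal hi1, ← ofReal_integral_eq_lintegral_ofReal hi2]
  · exact ENNReal.ofReal_le_ofReal key
  · refine (ae_restrict_iff' measurableSet_Icc).2 (ae_of_all _ fun x hx => ?_)
    exact mul_nonneg (div_nonneg (sq_nonneg _) (hpos x hx).le) (Real.exp_pos _).le
  · exact ae_of_all _ fun x => mul_nonneg (sq_nonneg _) (Real.exp_pos _).le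

/-! ### The open half-line `(l, ∞)` by exhaustion -/

/-- The compact intervals `[l + (a-l)/(n+2), a + n]` exhaust `(l, ∞)` when `l < a`. [folklore] -/
private theorem iUnion_Icc_exhaust_Ioi {l a : ℝ} (hla : l < a) :
    (⋃ n : ℕ, Icc (l + (a - l) / ((n : ℝ) + 2)) (a + n)) = Ioi l := by
  apply Subset.antisymm
  · intro x hx
    obtain ⟨n, hn⟩ := mem_iUnion.1 hx
    have : 0 < (a - l) / ((n : ℝ) + 2) := div_pos (by linarith) (by positivity)
    exact lt_of_lt_of_le (by linarith) hn.1
  · intro x hx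
    rw [mem_Ioi] at hx
    obtain ⟨n, hn⟩ := exists_nat_ge (max ((a - l) / (x - l)) (x - a))
    refine mem_iUnion.2 ⟨n, ?_, ?_⟩
    · have hxl : 0 < x - l := by linarith
      have h1 : (a - l) / (x - l) ≤ (n : ℝ) + 2 := by
        linarith [le_max_left ((a - l) / (x - l)) (x - a)]
      have h2 : (a - l) / ((n : ℝ) + 2) ≤ x - l := by
        rw [div_le_iff₀ (by positivity)]
        have := (div_le_iff₀ hxl).1 h1
        linarith
      linarith
    · linarith [le_max_right ((a - l) / (x - l)) (x - a)]

/-- **Brascamp–Lieb on an open half-line (extended integrals).** Let `g ∈ C²(l, ∞)` with `g'' > 0`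
continuous, `g' a = 0` at some `a > l`, and `H ∈ C¹(l, ∞)`. Then
`∫_{(l,∞)} (H − H a)² e^{−g} ≤ ∫_{(l,∞)} H'²/g'' e^{−g}` as extended integrals (no integrability
hypotheses). From the compact-interval form by monotone convergence.
[cite: BrascampLieb1976, Thm 4.1 (n = 1)] -/
theorem brascampLieb_Ioi {l a : ℝ} (hla : l < a) {g g₁ g₂ H H₁ : ℝ → ℝ}
    (hg : ∀ x ∈ Ioi l, HasDerivAt g (g₁ x) x) (hg₁ : ∀ x ∈ Ioi l, HasDerivAt g₁ (g₂ x) x)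
    (hH : ∀ x ∈ Ioi l, HasDerivAt H (H₁ x) x)
    (hg₂c : ContinuousOn g₂ (Ioi l)) (hH₁c : ContinuousOn H₁ (Ioi l))
    (hpos : ∀ x ∈ Ioi l, 0 < g₂ x) (hga : g₁ a = 0) :
    ∫⁻ x in Ioi l, ENNReal.ofReal ((H x - H a) ^ 2 * Real.exp (-g x)) ≤
      ∫⁻ x in Ioi l, ENNReal.ofReal ((H₁ x) ^ 2 / g₂ x * Real.exp (-g x)) := by
  set s : ℕ → Set ℝ := fun n => Icc (l + (a - l) / ((n : ℝ) + 2)) (a + n) with hs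
  have hαa : ∀ n : ℕ, l + (a - l) / ((n : ℝ) + 2) ≤ a := by
    intro n
    have h2 : (a - l) / ((n : ℝ) + 2) ≤ (a - l) / 1 :=
      div_le_div_of_nonneg_left (by linarith) one_pos (by linarith [n.cast_nonneg (α := ℝ)])
    rw [div_one] at h2
    linarith
  have haβ : ∀ n : ℕ, a ≤ a + n := fun n => by linarith [n.cast_nonneg (α := ℝ)]
  have hsub : ∀ n, s n ⊆ Ioi l := by
    intro n x hx
    have : 0 < (a - l) / ((n : ℝ) + 2) := div_pos (by linarith) (by positivity)
    exact lt_of_lt_of_le (by linarith) hx.1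
  have hmono : Monotone s := by
    intro n m hnm
    have hnm' : (n : ℝ) ≤ m := by exact_mod_cast hnm
    refine Icc_subset_Icc ?_ (by linarith)
    have : (a - l) / ((m : ℝ) + 2) ≤ (a - l) / ((n : ℝ) + 2) :=
      div_le_div_of_nonneg_left (by linarith) (by positivity) (by linarith)
    linarith
  have hdir : Directed (· ⊆ ·) s := hmono.directed_le
  have hU : (⋃ n, s n) = Ioi l := iUnion_Icc_exhaust_Ioi hla
  rw [← hU, setLIntegral_iUnion_of_directed _ hdir]
  refine iSup_le fun n => ?_
  have hn : ∀ x ∈ s n, x ∈ Ioi l := fun x hx => hsub n hx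
  calc ∫⁻ x in s n, ENNReal.ofReal ((H x - H a) ^ 2 * Real.exp (-g x))
      ≤ ∫⁻ x in s n, ENNReal.ofReal ((H₁ x) ^ 2 / g₂ x * Real.exp (-g x)) :=
        lintegral_Icc_brascampLieb_of_deriv_eq_zero (hαa n) (haβ n)
          (fun x hx => hg x (hn x hx)) (fun x hx => hg₁ x (hn x hx)) (fun x hx => hH x (hn x hx))
          (hg₂c.mono (hsub n)) (hH₁c.mono (hsub n)) (fun x hx => hpos x (hn x hx)) hga
    _ ≤ ∫⁻ x in ⋃ n, s n, ENNReal.ofReal ((H₁ x) ^ 2 / g₂ x * Real.exp (-g x)) :=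
        lintegral_mono_set (subset_iUnion s n)

/-! ### Second moment under a two-piece curvature floor -/

/-- **Second moment about the mode under a two-piece curvature floor** (extended integrals): if in
addition to the hypotheses of `brascampLieb_Ioi` one has `g'' ≥ ρ > 0` on `(l,∞) ∩ [b,∞)` and
`g'' ≥ ρ' > 0` on `(l, b)`, then
`∫_{(l,∞)} (x − a)² e^{−g} ≤ ρ⁻¹ ∫_{(l,∞)∩[b,∞)} e^{−g} + ρ'⁻¹ ∫_{(l,∞)∩(−∞,b)} e^{−g}`
(Brascamp–Lieb with `H = id`, then `1/g'' ≤ 1/ρ`, `1/ρ'` on the two pieces).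
[cite: BrascampLieb1976, Thm 4.1 (n = 1)] -/
theorem lintegral_sq_sub_mul_exp_neg_le_of_curvature {l a b ρ ρ' : ℝ} (hla : l < a)
    {g g₁ g₂ : ℝ → ℝ}
    (hg : ∀ x ∈ Ioi l, HasDerivAt g (g₁ x) x) (hg₁ : ∀ x ∈ Ioi l, HasDerivAt g₁ (g₂ x) x)
    (hg₂c : ContinuousOn g₂ (Ioi l)) (hpos : ∀ x ∈ Ioi l, 0 < g₂ x) (hga : g₁ a = 0)
    (hρ : 0 < ρ) (hρ' : 0 < ρ')
    (hfloor : ∀ x ∈ Ioi l, b ≤ x → ρ ≤ g₂ x) (hfloor' : ∀ x ∈ Ioi l, x < b → ρ' ≤ g₂ x) :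
    ∫⁻ x in Ioi l, ENNReal.ofReal ((x - a) ^ 2 * Real.exp (-g x)) ≤
      ENNReal.ofReal ρ⁻¹ * (∫⁻ x in Ioi l ∩ Ici b, ENNReal.ofReal (Real.exp (-g x))) +
      ENNReal.ofReal ρ'⁻¹ * (∫⁻ x in Ioi l ∩ Iio b, ENNReal.ofReal (Real.exp (-g x))) := by
  have key := brascampLieb_Ioi hla (H := fun x => x) (H₁ := fun _ => (1 : ℝ)) hg hg₁
    (fun x _ => hasDerivAt_id x) hg₂c continuousOn_const hpos hga
  refine key.trans ?_
  have hsplit : Ioi l = (Ioi l ∩ Ici b) ∪ (Ioi l ∩ Iio b) := by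
    rw [← inter_union_distrib_left, Ici_union_Iio, inter_univ]
  have hdisj : Disjoint (Ioi l ∩ Ici b) (Ioi l ∩ Iio b) :=
    Disjoint.mono inter_subset_right inter_subset_right
      (disjoint_left.2 fun x hx hx' => (not_lt.2 (mem_Ici.1 hx)) (mem_Iio.1 hx'))
  have hL : ∫⁻ x in Ioi l, ENNReal.ofReal ((1 : ℝ) ^ 2 / g₂ x * Real.exp (-g x)) =
      (∫⁻ x in Ioi l ∩ Ici b, ENNReal.ofReal ((1 : ℝ) ^ 2 / g₂ x * Real.exp (-g x))) +
      ∫⁻ x in Ioi l ∩ Iio b, ENNReal.ofReal ((1 : ℝ) ^ 2 / g₂ x * Real.exp (-g x)) := by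
    rw [← lintegral_union (measurableSet_Ioi.inter measurableSet_Iio) hdisj, ← hsplit]
  rw [hL]
  refine add_le_add ?_ ?_
  · rw [← lintegral_const_mul' _ _ ENNReal.ofReal_ne_top]
    refine setLIntegral_mono' (measurableSet_Ioi.inter measurableSet_Ici) fun x hx => ?_
    rw [← ENNReal.ofReal_mul (inv_nonneg.2 hρ.le)]
    refine ENNReal.ofReal_le_ofReal ?_
    have hx2 : ρ ≤ g₂ x := hfloor x hx.1 hx.2
    have : (1 : ℝ) ^ 2 / g₂ x ≤ ρ⁻¹ := by
      rw [one_pow, one_div]; exact inv_anti₀ hρ hx2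
    exact mul_le_mul_of_nonneg_right this (Real.exp_pos _).le
  · rw [← lintegral_const_mul' _ _ ENNReal.ofReal_ne_top]
    refine setLIntegral_mono' (measurableSet_Ioi.inter measurableSet_Iio) fun x hx => ?_
    rw [← ENNReal.ofReal_mul (inv_nonneg.2 hρ'.le)]
    refine ENNReal.ofReal_le_ofReal ?_
    have hx2 : ρ' ≤ g₂ x := hfloor' x hx.1 hx.2
    have : (1 : ℝ) ^ 2 / g₂ x ≤ ρ'⁻¹ := by
      rw [one_pow, one_div]; exact inv_anti₀ hρ' hx2
    exact mul_le_mul_of_nonneg_right this (Real.exp_pos _).le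

/-- **Second moment about the mode under a two-piece curvature floor (Bochner form).** Under the
hypotheses of `lintegral_sq_sub_mul_exp_neg_le_of_curvature`, if `e^{−g}` is integrable on
`(l, ∞)`, then so is `(x − a)² e^{−g}`, and
`∫_{(l,∞)} (x − a)² e^{−g} ≤ ρ⁻¹ ∫_{(l,∞)∩[b,∞)} e^{−g} + ρ'⁻¹ ∫_{(l,∞)∩(−∞,b)} e^{−g}`.
[cite: BrascampLieb1976, Thm 4.1 (n = 1)] -/
theorem integral_sq_sub_mul_exp_neg_le_of_curvature {l a b ρ ρ' : ℝ} (hla : l < a)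
    {g g₁ g₂ : ℝ → ℝ}
    (hg : ∀ x ∈ Ioi l, HasDerivAt g (g₁ x) x) (hg₁ : ∀ x ∈ Ioi l, HasDerivAt g₁ (g₂ x) x)
    (hg₂c : ContinuousOn g₂ (Ioi l)) (hpos : ∀ x ∈ Ioi l, 0 < g₂ x) (hga : g₁ a = 0)
    (hρ : 0 < ρ) (hρ' : 0 < ρ')
    (hfloor : ∀ x ∈ Ioi l, b ≤ x → ρ ≤ g₂ x) (hfloor' : ∀ x ∈ Ioi l, x < b → ρ' ≤ g₂ x)
    (hint : IntegrableOn (fun x => Real.exp (-g x)) (Ioi l)) :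
    IntegrableOn (fun x => (x - a) ^ 2 * Real.exp (-g x)) (Ioi l) ∧
    ∫ x in Ioi l, (x - a) ^ 2 * Real.exp (-g x) ≤
      ρ⁻¹ * (∫ x in Ioi l ∩ Ici b, Real.exp (-g x)) + ρ'⁻¹ * (∫ x in Ioi l ∩ Iio b, Real.exp (-g x)) := by
  have key := lintegral_sq_sub_mul_exp_neg_le_of_curvature hla hg hg₁ hg₂c hpos hga hρ hρ'
    hfloor hfloor'
  have hgc : ContinuousOn g (Ioi l) := fun x hx => (hg x hx).continuousAt.continuousWithinAt
  have hcont : ContinuousOn (fun x => (x - a) ^ 2 * Real.exp (-g x)) (Ioi l) :=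
    ((continuousOn_id.sub continuousOn_const).pow 2).mul hgc.neg.rexp
  have hmeas : AEStronglyMeasurable (fun x => (x - a) ^ 2 * Real.exp (-g x))
      (volume.restrict (Ioi l)) :=
    hcont.aestronglyMeasurable measurableSet_Ioi
  have hint1 : IntegrableOn (fun x => Real.exp (-g x)) (Ioi l ∩ Ici b) :=
    hint.mono_set inter_subset_left
  have hint2 : IntegrableOn (fun x => Real.exp (-g x)) (Ioi l ∩ Iio b) :=
    hint.mono_set inter_subset_left
  have e1 : ∫⁻ x in Ioi l ∩ Ici b, ENNReal.ofReal (Real.exp (-g x)) =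
      ENNReal.ofReal (∫ x in Ioi l ∩ Ici b, Real.exp (-g x)) :=
    (ofReal_integral_eq_lintegral_ofReal hint1 (ae_of_all _ fun x => (Real.exp_pos _).le)).symm
  have e2 : ∫⁻ x in Ioi l ∩ Iio b, ENNReal.ofReal (Real.exp (-g x)) =
      ENNReal.ofReal (∫ x in Ioi l ∩ Iio b, Real.exp (-g x)) :=
    (ofReal_integral_eq_lintegral_ofReal hint2 (ae_of_all _ fun x => (Real.exp_pos _).le)).symm
  have hI1 : 0 ≤ ∫ x in Ioi l ∩ Ici b, Real.exp (-g x) :=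
    setIntegral_nonneg (measurableSet_Ioi.inter measurableSet_Ici) fun x _ => (Real.exp_pos _).le
  have hI2 : 0 ≤ ∫ x in Ioi l ∩ Iio b, Real.exp (-g x) :=
    setIntegral_nonneg (measurableSet_Ioi.inter measurableSet_Iio) fun x _ => (Real.exp_pos _).le
  set R : ℝ := ρ⁻¹ * (∫ x in Ioi l ∩ Ici b, Real.exp (-g x)) +
    ρ'⁻¹ * (∫ x in Ioi l ∩ Iio b, Real.exp (-g x)) with hR
  have hR0 : 0 ≤ R := by positivity
  have hRHS : ENNReal.ofReal ρ⁻¹ * (∫⁻ x in Ioi l ∩ Ici b, ENNReal.ofReal (Real.exp (-g x))) +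
      ENNReal.ofReal ρ'⁻¹ * (∫⁻ x in Ioi l ∩ Iio b, ENNReal.ofReal (Real.exp (-g x))) =
      ENNReal.ofReal R := by
    rw [e1, e2, ← ENNReal.ofReal_mul (inv_nonneg.2 hρ.le), ← ENNReal.ofReal_mul (inv_nonneg.2 hρ'.le),
      ← ENNReal.ofReal_add (by positivity) (by positivity)]
  have key' : ∫⁻ x in Ioi l, ENNReal.ofReal ((x - a) ^ 2 * Real.exp (-g x)) ≤ ENNReal.ofReal R :=
    key.trans hRHS.le
  have hfin : HasFiniteIntegral (fun x => (x - a) ^ 2 * Real.exp (-g x)) (volume.restrict (Ioi l)) := by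
    rw [hasFiniteIntegral_iff_ofReal (ae_of_all _ fun x => mul_nonneg (sq_nonneg _) (Real.exp_pos _).le)]
    exact lt_of_le_of_lt key' ENNReal.ofReal_lt_top
  have hI : IntegrableOn (fun x => (x - a) ^ 2 * Real.exp (-g x)) (Ioi l) := ⟨hmeas, hfin⟩
  refine ⟨hI, ?_⟩
  have := (ENNReal.ofReal_le_ofReal_iff hR0).1
    (by rwa [ofReal_integral_eq_lintegral_ofReal hI
      (ae_of_all _ fun x => mul_nonneg (sq_nonneg _) (Real.exp_pos _).le)])
  exact this

/-! ### Mean versus an arbitrary centre (elementary) -/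

/-- For a nonnegative weight `w` on a set `s` with mass `Z = ∫_s w > 0`, first moment `∫_s x w` and
finite second moment about `a`: the mean `ū = (∫_s x w)/Z` satisfies
`(ū − a)² ≤ (∫_s (x − a)² w)/Z` — the step "`var h ≤ ⟨(h − ⟨h⟩)²⟩ ≤ ⟨(h − h(a))²⟩`" of the printed
proof (second moment about `a` = variance + `Z(ū − a)²`).
[cite: BrascampLieb1976, Thm 4.1 (proof, p. 377)] -/
theorem sq_mean_sub_le_div {s : Set ℝ} {w : ℝ → ℝ} {a : ℝ} (hs : MeasurableSet s)
    (hw : ∀ x ∈ s, 0 ≤ w x)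
    (h0 : IntegrableOn w s) (h2 : IntegrableOn (fun x => (x - a) ^ 2 * w x) s)
    (hZ : 0 < ∫ x in s, w x) :
    IntegrableOn (fun x => (x - a) * w x) s ∧
    ((∫ x in s, x * w x) / (∫ x in s, w x) - a) ^ 2 ≤ (∫ x in s, (x - a) ^ 2 * w x) / ∫ x in s, w x := by
  -- integrability of the first moment about `a`: `|x - a| w ≤ ((x-a)² + 1) w`
  have h1 : IntegrableOn (fun x => (x - a) * w x) s := by
    have hdom : IntegrableOn (fun x => (x - a) ^ 2 * w x + w x) s := h2.add h0
    refine hdom.mono' ?_ ?_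
    · exact ((continuous_id.sub continuous_const).aestronglyMeasurable.restrict).mul h0.1
    · refine (ae_restrict_iff' hs).2 (ae_of_all _ fun x hx => ?_)
      rw [Real.norm_eq_abs, abs_mul, abs_of_nonneg (hw x hx)]
      have : |x - a| ≤ (x - a) ^ 2 + 1 := by
        rcases le_or_gt 1 |x - a| with h | h
        · calc |x - a| ≤ |x - a| * |x - a| := le_mul_of_one_le_left (abs_nonneg _) h
            _ = (x - a) ^ 2 := by rw [← sq, sq_abs]
            _ ≤ (x - a) ^ 2 + 1 := by linarith
        · linarith [sq_nonneg (x - a)]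
      calc |x - a| * w x ≤ ((x - a) ^ 2 + 1) * w x := mul_le_mul_of_nonneg_right this (hw x hx)
        _ = (x - a) ^ 2 * w x + w x := by ring
  refine ⟨h1, ?_⟩
  set Z := ∫ x in s, w x with hZdef
  set A := ∫ x in s, (x - a) * w x with hA
  set B := ∫ x in s, (x - a) ^ 2 * w x with hB
  -- `∫ x w = A + a Z`
  have hxw : IntegrableOn (fun x => x * w x) s := by
    have : (fun x => x * w x) = fun x => (x - a) * w x + a * w x := by funext x; ring
    rw [this]; exact h1.add (h0.const_mul a)
  have hfirst : ∫ x in s, x * w x = A + a * Z := by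
    have : (fun x => x * w x) = fun x => (x - a) * w x + a * w x := by funext x; ring
    rw [this, integral_add h1 (h0.const_mul a), integral_const_mul]
  have hmean : (∫ x in s, x * w x) / Z - a = A / Z := by
    rw [hfirst]; field_simp; ring
  rw [hmean]
  -- `0 ≤ ∫ ((x - a) - A/Z)² w = B - A²/Z`
  have ht : IntegrableOn (fun x => ((x - a) - A / Z) ^ 2 * w x) s := by
    have : (fun x => ((x - a) - A / Z) ^ 2 * w x) =
        fun x => (x - a) ^ 2 * w x + (-(2 * (A / Z))) * ((x - a) * w x) + (A / Z) ^ 2 * w x := by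
      funext x; ring
    rw [this]; exact (h2.add (h1.const_mul _)).add (h0.const_mul _)
  have hnn : 0 ≤ ∫ x in s, ((x - a) - A / Z) ^ 2 * w x :=
    setIntegral_nonneg hs fun x hx => mul_nonneg (sq_nonneg _) (hw x hx)
  have hexp : ∫ x in s, ((x - a) - A / Z) ^ 2 * w x = B - A ^ 2 / Z := by
    have hfun : (fun x => ((x - a) - A / Z) ^ 2 * w x) =
        fun x => ((x - a) ^ 2 * w x + (-(2 * (A / Z))) * ((x - a) * w x)) + (A / Z) ^ 2 * w x := by
      funext x; ring
    have i12 : IntegrableOn (fun x => (x - a) ^ 2 * w x + (-(2 * (A / Z))) * ((x - a) * w x)) s :=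
      h2.add (h1.const_mul _)
    have s1 : ∫ x in s, ((x - a) ^ 2 * w x + (-(2 * (A / Z))) * ((x - a) * w x)) + (A / Z) ^ 2 * w x =
        (∫ x in s, (x - a) ^ 2 * w x + (-(2 * (A / Z))) * ((x - a) * w x)) +
        ∫ x in s, (A / Z) ^ 2 * w x := integral_add i12 (h0.const_mul _)
    have s2 : ∫ x in s, (x - a) ^ 2 * w x + (-(2 * (A / Z))) * ((x - a) * w x) =
        (∫ x in s, (x - a) ^ 2 * w x) + ∫ x in s, (-(2 * (A / Z))) * ((x - a) * w x) :=
      integral_add h2 (h1.const_mul _)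
    rw [hfun, s1, s2, integral_const_mul, integral_const_mul, ← hA, ← hB, ← hZdef]
    field_simp
    ring
  rw [hexp] at hnn
  rw [div_pow, le_div_iff₀ hZ]
  have : A ^ 2 / Z ^ 2 * Z = A ^ 2 / Z := by field_simp
  rw [this]
  linarith

/-- The second moment about the mean is at most the second moment about any centre `a`:
`∫_s (x − ū)² w ≤ ∫_s (x − a)² w` with `ū = (∫_s x w)/(∫_s w)`; indeed the difference is
`Z (ū − a)²` (the step "`var h ≤ ⟨(h − h(a))²⟩`" of the printed proof, as an identity).
[cite: BrascampLieb1976, Thm 4.1 (proof, p. 377)] -/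
theorem integral_sq_sub_mean_le {s : Set ℝ} {w : ℝ → ℝ} {a : ℝ} (hs : MeasurableSet s)
    (hw : ∀ x ∈ s, 0 ≤ w x)
    (h0 : IntegrableOn w s) (h2 : IntegrableOn (fun x => (x - a) ^ 2 * w x) s)
    (hZ : 0 < ∫ x in s, w x) :
    IntegrableOn (fun x => (x - (∫ x in s, x * w x) / (∫ x in s, w x)) ^ 2 * w x) s ∧
    ∫ x in s, (x - (∫ x in s, x * w x) / (∫ x in s, w x)) ^ 2 * w x =
      (∫ x in s, (x - a) ^ 2 * w x) - (∫ x in s, w x) * ((∫ x in s, x * w x) / (∫ x in s, w x) - a) ^ 2 := by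
  obtain ⟨h1, -⟩ := sq_mean_sub_le_div hs hw h0 h2 hZ
  set Z := ∫ x in s, w x with hZdef
  set u := (∫ x in s, x * w x) / Z with hu
  have hxw_eq : (fun x => x * w x) = fun x => (x - a) * w x + a * w x := by funext x; ring
  have hfirst : ∫ x in s, x * w x = (∫ x in s, (x - a) * w x) + a * Z := by
    rw [hxw_eq, integral_add h1 (h0.const_mul a), integral_const_mul]
  have hexpand : (fun x => (x - u) ^ 2 * w x) =
      fun x => ((x - a) ^ 2 * w x + (-(2 * (u - a))) * ((x - a) * w x)) + (u - a) ^ 2 * w x := by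
    funext x; ring
  have i12 : IntegrableOn (fun x => (x - a) ^ 2 * w x + (-(2 * (u - a))) * ((x - a) * w x)) s :=
    h2.add (h1.const_mul _)
  have hI : IntegrableOn (fun x => (x - u) ^ 2 * w x) s := by
    rw [hexpand]; exact i12.add (h0.const_mul _)
  refine ⟨hI, ?_⟩
  have s1 : ∫ x in s, ((x - a) ^ 2 * w x + (-(2 * (u - a))) * ((x - a) * w x)) + (u - a) ^ 2 * w x =
      (∫ x in s, (x - a) ^ 2 * w x + (-(2 * (u - a))) * ((x - a) * w x)) +
      ∫ x in s, (u - a) ^ 2 * w x := integral_add i12 (h0.const_mul _)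
  have s2 : ∫ x in s, (x - a) ^ 2 * w x + (-(2 * (u - a))) * ((x - a) * w x) =
      (∫ x in s, (x - a) ^ 2 * w x) + ∫ x in s, (-(2 * (u - a))) * ((x - a) * w x) :=
    integral_add h2 (h1.const_mul _)
  have hA : ∫ x in s, (x - a) * w x = (u - a) * Z := by
    have hZne : Z ≠ 0 := hZ.ne'
    rw [hu, hfirst]; field_simp; ring
  rw [hexpand, s1, s2, integral_const_mul, integral_const_mul, hA, ← hZdef]
  ring

end Literature.Probability.Distributions
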